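import Mathlib.RingTheory.Spectrum.Prime.FreeLocus
import Mathlib.RingTheory.Smooth.Locus
import Mathlib.RingTheory.Localization.LocalizationLocalization
import Mathlib.RingTheory.Spectrum.Prime.Noetherian
import Literature.AlgebraicGeometry.Resolution.StrictlyStandardPowers
import HarnessLib

/-!
# Charts for the lifting lemma (Stacks 07CP, first paragraph; cf. Lemma 07C6)

Topic: `Literature/AlgebraicGeometry/Resolution`. The Stacks Project, *Smoothing Ring Maps*
(Tag 07BW), proof of Lemma 07CP (the lifting lemma), first paragraph:

> We choose a presentation `C̄ = R[x_1, …, x_n]/(f_1, …, f_m)` … Since `R` is Noetherian, so is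
> `C̄`. Hence the smooth locus of `R/π²R → C̄` is quasi-compact, see Topology, Lemma [Noetherian].
> Applying Lemma 07C6 we may choose a finite list of elements `a_1, …, a_r ∈ R[x_1, …, x_n]` such
> that (1) the union of the open subspaces `Spec(C̄_{a_k}) ⊂ Spec(C̄)` cover the smooth locus of
> `R/π²R → C̄`, and (2) for each `k = 1, …, r` there exists a finite subset `E_k ⊂ {1, …, m}` such
> that `(Ī/Ī²)_{a_k}` is freely generated by the classes of `f_j`, `j ∈ E_k`.

This file proves the covering statement for a finitely presented algebra `C` over a Noetherian
ring `R'` with generators `G` (kernel `I`, conormal module `I/I² = G.toExtension.Cotangent`):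
finitely many `a` with `C_a` smooth over `R'` and `(I/I²)_a` free on classes `1 ⊗ b̄_k` of
elements `b_k ∈ I`, whose basic opens cover the smooth locus (`exists_finite_charts`). Instead of
Lemma 07C6 (whose basis elements are among the given `f_j`) we allow arbitrary `b_k ∈ I` — in the
proof of 07CP one then simply enlarges the list of relations by these `b_k` (the ideal `I` is
unchanged), which is all (2) is used for. Route: a prime in the smooth locus lies in the free locus
of `I/I²` (`mem_freeLocus_cotangent`: `(I/I²)_𝔮` is a localization of the projective module
`(I/I²)_a`, `C_a` smooth, `Stacks07EZ.free_locCot_prod`), Mathlib's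
`Module.FinitePresentation.exists_free_localizedModule_powers`, base change
(`exists_chart`), clearing denominators (`Stacks07EZ.exists_basis_tmul_mk`) and compactness of
the Noetherian spectrum.

## References

* The Stacks Project, *Smoothing Ring Maps* (Tag 07BW), proof of Lemma 07CP; Lemma 07C6.
  [StacksProject]
-/

noncomputable section

open MvPolynomial TensorProduct

namespace Literature.AlgebraicGeometry.Resolution

namespace Stacks07CP

universe u

variable {R' C : Type u} [CommRing R'] [CommRing C] [Algebra R' C] [IsNoetherianRing R']
  [Algebra.FinitePresentation R' C] {ι : Type} [Fintype ι] (G : Algebra.Generators R' C ι)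

omit [IsNoetherianRing R'] [Algebra.FinitePresentation R' C] [Fintype ι] in
/-- `C_a` smooth ⇒ `(I/I²)_a` is finite projective. [cite: StacksProject, Tag 07C6] -/
theorem projective_locCot (a : C) [Algebra.FormallySmooth R' (Localization.Away a)] :
    Module.Projective (Localization.Away a) (Stacks07EZ.LocCot G a) :=
  haveI := Stacks07EZ.free_locCot_prod G a (R := R')
  Module.Projective.of_split (LinearMap.inl (Localization.Away a) _
    (Localization.Away a ⊗[C] (Ω[C⁄R']))) (LinearMap.fst _ _ _) (LinearMap.ext fun _ => rfl)

omit [IsNoetherianRing R'] in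
/-- **Chart lemma, step 1**: a prime in the smooth locus lies in the free locus of the conormal
module `I/I²` (as `(I/I²)_𝔮` is a localization of the projective `(I/I²)_a`, `C_a` smooth).
[cite: StacksProject, Tag 07C6] -/
theorem mem_freeLocus_cotangent (𝔮 : PrimeSpectrum C) (h𝔮 : 𝔮 ∈ Algebra.smoothLocus R' C) :
    𝔮 ∈ Module.freeLocus C G.toExtension.Cotangent := by
  classical
  haveI : Algebra.IsSmoothAt R' 𝔮.asIdeal := h𝔮
  obtain ⟨a, ha, hsmooth⟩ := Algebra.IsSmoothAt.exists_notMem_smooth R' 𝔮.asIdeal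
  haveI := hsmooth
  haveI : Algebra.FormallySmooth R' (Localization.Away a) := Algebra.Smooth.formallySmooth
  haveI := projective_locCot G a (R' := R')
  -- the prime `𝔮 C_a` of `C_a` and the local ring there
  let Ca := Localization.Away a
  have hdisj : Disjoint (Submonoid.powers a : Set C) (𝔮.asIdeal : Set C) := by
    rw [Set.disjoint_left]
    rintro _ ⟨k, rfl⟩ hk
    exact ha (𝔮.isPrime.mem_of_pow_mem k hk)
  let 𝔮a : Ideal Ca := 𝔮.asIdeal.map (algebraMap C Ca)
  haveI : 𝔮a.IsPrime := IsLocalization.isPrime_of_isPrime_disjoint (Submonoid.powers a) Ca _ 𝔮.isPrime hdisj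
  have hcomap : 𝔮a.comap (algebraMap C Ca) = 𝔮.asIdeal :=
    IsLocalization.under_map_of_isPrime_disjoint (Submonoid.powers a) Ca 𝔮.isPrime hdisj
  let L := Localization.AtPrime 𝔮a
  -- `L` is `C_𝔮`
  haveI hL : IsLocalization.AtPrime L (𝔮a.comap (algebraMap C Ca)) := inferInstance
  have e : (𝔮a.comap (algebraMap C Ca)).primeCompl = 𝔮.asIdeal.primeCompl :=
    Submonoid.ext fun x => by
      change x ∉ 𝔮a.comap (algebraMap C Ca) ↔ x ∉ 𝔮.asIdeal
      rw [hcomap]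
  haveI : IsLocalization.AtPrime L 𝔮.asIdeal := (e ▸ hL : IsLocalization 𝔮.asIdeal.primeCompl L)
  -- the model `L ⊗_{C_a} (I/I²)_a` of `(I/I²)_𝔮`
  let M₁ := Stacks07EZ.LocCot G a
  let Mp := L ⊗[Ca] M₁
  haveI : Module.Projective L Mp := inferInstance
  haveI : Module.Finite C G.toExtension.Cotangent :=
    Algebra.Extension.Cotangent.finite G.fg_ker_of_finitePresentation
  haveI : Module.Finite L Mp := inferInstance
  haveI : Module.Free L Mp := Module.free_of_flat_of_isLocalRing (R := L) (P := Mp)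
  -- `C`-linear map `I/I² → Mp` which is a localization at `𝔮`
  let f : G.toExtension.Cotangent →ₗ[C] Mp :=
    ((TensorProduct.mk Ca L M₁ 1).restrictScalars C) ∘ₗ
      (TensorProduct.mk C Ca G.toExtension.Cotangent 1)
  have hf : IsBaseChange L f :=
    IsBaseChange.comp (TensorProduct.isBaseChange C G.toExtension.Cotangent Ca)
      (TensorProduct.isBaseChange Ca M₁ L)
  haveI : IsLocalizedModule 𝔮.asIdeal.primeCompl f :=
    (isLocalizedModule_iff_isBaseChange 𝔮.asIdeal.primeCompl L f).mpr hf
  exact (Module.mem_freeLocus_of_isLocalization 𝔮 L Mp f).mpr ‹_›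

/-- **Chart lemma, step 2**: some `r ∉ 𝔮` makes `(I/I²)_r` free. [cite: StacksProject, Tag 07C6] -/
theorem exists_free_localizedModule (𝔮 : PrimeSpectrum C) (h𝔮 : 𝔮 ∈ Algebra.smoothLocus R' C) :
    ∃ r : C, r ∉ 𝔮.asIdeal ∧ Module.Free (Localization (Submonoid.powers r))
      (LocalizedModule.Away r G.toExtension.Cotangent) := by
  haveI : Module.Finite C G.toExtension.Cotangent :=
    Algebra.Extension.Cotangent.finite G.fg_ker_of_finitePresentation
  haveI : IsNoetherianRing C := Algebra.FiniteType.isNoetherianRing R' C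
  haveI : Module.FinitePresentation C G.toExtension.Cotangent :=
    Module.finitePresentation_of_finite C _
  have hfree : Module.Free (Localization.AtPrime 𝔮.asIdeal)
      (LocalizedModule 𝔮.asIdeal.primeCompl G.toExtension.Cotangent) :=
    mem_freeLocus_cotangent G 𝔮 h𝔮
  obtain ⟨r, hr, hfree', -⟩ := Module.FinitePresentation.exists_free_localizedModule_powers
    𝔮.asIdeal.primeCompl (LocalizedModule.mkLinearMap 𝔮.asIdeal.primeCompl G.toExtension.Cotangent)
    (Localization.AtPrime 𝔮.asIdeal)
  exact ⟨r, hr, hfree'⟩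

/-- **Chart lemma** (replacement for Stacks 07C6 in the proof of 07CP): for a prime `𝔮` in the
smooth locus there is `a ∉ 𝔮` with `C_a` smooth over `R'` and `(I/I²)_a` free over `C_a`.
[cite: StacksProject, Tag 07C6] -/
theorem exists_chart (𝔮 : PrimeSpectrum C) (h𝔮 : 𝔮 ∈ Algebra.smoothLocus R' C) :
    ∃ a : C, a ∉ 𝔮.asIdeal ∧ Algebra.Smooth R' (Localization.Away a) ∧
      Module.Free (Localization.Away a) (Stacks07EZ.LocCot G a) := by
  classical
  haveI : Algebra.IsSmoothAt R' 𝔮.asIdeal := h𝔮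
  obtain ⟨a₁, ha₁, hsmooth⟩ := Algebra.IsSmoothAt.exists_notMem_smooth R' 𝔮.asIdeal
  haveI := hsmooth
  obtain ⟨r, hr, hfree⟩ := exists_free_localizedModule G 𝔮 h𝔮
  haveI := hfree
  refine ⟨a₁ * r, fun h => (𝔮.isPrime.mem_or_mem h).elim ha₁ hr, ?_, ?_⟩
  · -- `C_{a₁ r}` is a localization of the smooth `C_{a₁}`
    let S₁ := Localization.Away a₁
    let T := Localization.Away (algebraMap C S₁ r)
    haveI : Algebra.Smooth S₁ T := Algebra.Smooth.of_isLocalization_Away (algebraMap C S₁ r)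
    haveI : Algebra.Smooth R' T := Algebra.Smooth.comp R' S₁ T
    haveI : IsLocalization.Away (a₁ * r) T := inferInstance
    let e : T ≃ₐ[C] Localization.Away (a₁ * r) :=
      IsLocalization.algEquiv (Submonoid.powers (a₁ * r)) T (Localization.Away (a₁ * r))
    haveI : Algebra.FormallySmooth R' (Localization.Away (a₁ * r)) :=
      Algebra.FormallySmooth.of_equiv (e.restrictScalars R')
    haveI : Algebra.FinitePresentation R' (Localization.Away (a₁ * r)) :=
      Algebra.FinitePresentation.equiv (e.restrictScalars R')
    exact ⟨inferInstance, inferInstance⟩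
  · -- `(I/I²)_{a₁ r}` is a base change of the free `(I/I²)_r`
    let Cr := Localization (Submonoid.powers r)
    let Ca := Localization.Away (a₁ * r)
    have hunit : IsUnit (algebraMap C Ca r) :=
      isUnit_of_mul_isUnit_right (by
        rw [← map_mul]; exact IsLocalization.Away.algebraMap_isUnit (S := Ca) (a₁ * r))
    letI : Algebra Cr Ca := (IsLocalization.Away.lift r hunit).toAlgebra
    haveI : IsScalarTower C Cr Ca := IsScalarTower.of_algebraMap_eq fun x =>
      (IsLocalization.Away.lift_eq r hunit x).symm
    let e2 : Cr ⊗[C] G.toExtension.Cotangent ≃ₗ[Cr] LocalizedModule.Away r G.toExtension.Cotangent :=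
      (IsLocalizedModule.isBaseChange (Submonoid.powers r) Cr
        (LocalizedModule.mkLinearMap (Submonoid.powers r) G.toExtension.Cotangent)).equiv
    haveI : Module.Free Ca (Ca ⊗[Cr] (Cr ⊗[C] G.toExtension.Cotangent)) :=
      Module.Free.of_equiv (LinearEquiv.baseChange Cr Ca _ _ e2).symm
    exact Module.Free.of_equiv
      (TensorProduct.AlgebraTensorModule.cancelBaseChange C Cr Ca Ca G.toExtension.Cotangent)

/-- Chart with an explicit basis of `(I/I²)_a` consisting of classes of elements of `I`.
[cite: StacksProject, Tag 07C6] -/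
theorem exists_chart_basis (𝔮 : PrimeSpectrum C) (h𝔮 : 𝔮 ∈ Algebra.smoothLocus R' C) :
    ∃ a : C, a ∉ 𝔮.asIdeal ∧ Algebra.Smooth R' (Localization.Away a) ∧
      ∃ (c : ℕ) (b : Fin c → G.toExtension.ker)
        (B : Module.Basis (Fin c) (Localization.Away a) (Stacks07EZ.LocCot G a)),
        ∀ k, B k = (1 : Localization.Away a) ⊗ₜ[C] Algebra.Extension.Cotangent.mk (b k) := by
  obtain ⟨a, ha, hsmooth, hfree⟩ := exists_chart G 𝔮 h𝔮
  haveI := hfree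
  haveI : Module.Finite C G.toExtension.Cotangent :=
    Algebra.Extension.Cotangent.finite G.fg_ker_of_finitePresentation
  refine ⟨a, ha, hsmooth, ?_⟩
  rcases subsingleton_or_nontrivial (Localization.Away a) with h | h
  · haveI : Subsingleton (Stacks07EZ.LocCot G a) := Module.subsingleton (Localization.Away a) _
    exact ⟨0, Fin.elim0, Module.Basis.empty _, fun k => Fin.elim0 k⟩
  · obtain ⟨b, B, hB⟩ := Stacks07EZ.exists_basis_tmul_mk (G := G)
      (Module.finBasis (Localization.Away a) (Stacks07EZ.LocCot G a))
    exact ⟨_, b, B, hB⟩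

/-- **Finitely many charts cover the smooth locus** (Stacks 07CP: "Since `R` is Noetherian, so is
`C̄`. Hence the smooth locus … is quasi-compact … we may choose a finite list of elements
`a_1, …, a_r` …"). [cite: StacksProject, Tag 07CP] -/
theorem exists_finite_charts :
    ∃ t : Finset C, (∀ a ∈ t, Algebra.Smooth R' (Localization.Away a) ∧
      ∃ (c : ℕ) (b : Fin c → G.toExtension.ker)
        (B : Module.Basis (Fin c) (Localization.Away a) (Stacks07EZ.LocCot G a)),
        ∀ k, B k = (1 : Localization.Away a) ⊗ₜ[C] Algebra.Extension.Cotangent.mk (b k)) ∧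
      Algebra.smoothLocus R' C ⊆ ⋃ a ∈ t, (↑(PrimeSpectrum.basicOpen a) : Set (PrimeSpectrum C)) := by
  classical
  haveI : IsNoetherianRing C := Algebra.FiniteType.isNoetherianRing R' C
  choose a ha hchart using fun 𝔮 : Algebra.smoothLocus R' C => exists_chart_basis G 𝔮.1 𝔮.2
  have hcomp : IsCompact (Algebra.smoothLocus R' C) := TopologicalSpace.NoetherianSpace.isCompact _
  let U : Algebra.smoothLocus R' C → Set (PrimeSpectrum C) :=
    fun 𝔮 => (↑(PrimeSpectrum.basicOpen (a 𝔮)) : Set (PrimeSpectrum C))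
  obtain ⟨T, hT⟩ := hcomp.elim_finite_subcover U
    (fun 𝔮 => (PrimeSpectrum.basicOpen (a 𝔮)).2) fun x hx =>
      Set.mem_iUnion.mpr ⟨⟨x, hx⟩, ha ⟨x, hx⟩⟩
  refine ⟨T.image a, fun a' ha' => ?_, fun x hx => ?_⟩
  · obtain ⟨𝔮, -, rfl⟩ := Finset.mem_image.mp ha'
    exact hchart 𝔮
  · obtain ⟨𝔮, h𝔮T, hx𝔮⟩ : ∃ 𝔮 ∈ T, x ∈ (↑(PrimeSpectrum.basicOpen (a 𝔮)) : Set _) := by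
      simpa only [Set.mem_iUnion, exists_prop] using hT hx
    exact Set.mem_biUnion (Finset.mem_image_of_mem a h𝔮T) hx𝔮

end Stacks07CP

end Literature.AlgebraicGeometry.Resolution

end
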